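import Summits.QuantumFields.YangMills.Theorems.BalabanUVNodesN21ShellSplitOfRecord13CoPHStat
import Summits.QuantumFields.YangMills.Theorems.BalabanUVNodesSpineReadingOfRecord13CoPHV
import Summits.QuantumFields.YangMills.Theorems.BalabanUVNodesN21DilationRoadAtRecord13CoPH

/-!
# N21 (NE7c) · JUNCTION №2: dag-n21-d's END `shellWeightBound_crOfRecord₁₃At_shellSplit_of_blockFibreAC` (ONE `SlotAntiConcentration` per run ∕ K ∕ t ∕ top cube ∕
# exterior field, on the BLOCK FIBRE LAW of record) WITH THE DILATION ROAD's CONSTANT `D_K = M_K·3(d_K+1)∕(1−ρ_K)` — `0 ≤ D_K` and `Summable (D_K ρ_K)` DISCHARGED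
# (p583987 BY NAME) — and the V-EDITION TRANSFER of the shell face (`crOfRecord₁₃At ↔ crOfRecord₁₃VAt`, same carriers and canonical `Wsh`: `Iff.rfl`)

Track A of `YM-PLAN.md` (cell `pub-ymgap`, HUMAN RULING D-0062 ∕ D-0149 width seats), node **N21**; WIDTH SEAT `pub-ymgap-dag-n21-w2` (gen 0), W-SEAT-START-LIST §n21
ITEM 2, file 8 (the second junction file; the first, `…N21ShellSplitOfRecord13CoPHDilation` p595781, did the same for the term-level (M1) form).  THEOREMS ONLY: 0 `def`,
0 `sorry`; COUNT-NEUTRAL; `--kind proof --supports stmt-QuantumFields-20544 --as helper`.  Imports dag-n21-d g9's FILE 6 `…N21ShellSplitOfRecord13CoPHStat` (★★★★, `cubeStat`,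
`inputBlock`, `blockFibreLawOfDatum₉`, `blockReading`), n20-d's V edition and my p583987.  NO Theses import.  Restates nothing; cites by name.

WHAT IS PROVED ([bookkeeping]).
* §0 `shellWeightBound_crOfRecord₁₃VAt_iff_crOfRecord₁₃At` — for ANY shell split `sh`, NE7c's `ShellWeightBound` at the V-edition reading (own canonical `Wsh`) ⟺ at the v1.0 reading:
  the two readings have the same `l₀ ∕ T ∕ A ∕ B ∕ shA ∕ shB ∕ Wsh` (`Iff.rfl`; n20-d `crOfRecord₁₃VAt_T_eq` family) — the shell face is volume-blind, ONCE, for every producer.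
* ★★ `shellWeightBound_crOfRecord₁₃At_shellSplit_of_blockFibreAC_dilation` — dag-n21-d's ★★★★ with, per run, `D_K := M_K·3(d_K+1)∕(1−ρ_K)`: the binders `0 ≤ D_K` and
  `Summable (D_K ρ_K)` REPLACED by `0 ≤ M_K ≤ M̄(K^q+1)`, `0 ≤ d_K ≤ d₀(K^p+1)`, `0 ≤ ρ_K ≤ ½`, `ρ_K ≤ c₁ϑ^K`, `0 ≤ ϑ < 1` (p583987 `dilationCoeffConst_nonneg` ∕
  `summable_dilationCoeffConst_mul`); the ONE displayed estimate per (run, K, t, top cube a, exterior x) is `SlotAntiConcentration (blockFibreLawOfDatum₉ … x) (blockReading (cubeStat a) …) ε_k ρ_K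
  (M_K·3(d_K+1)∕(1−ρ_K))` — the dilation road's OUTPUT SHAPE (G28∕G31∕G34 ∕ p587240: `((1+Q)∕κ₀)·3(#block coords + 1)∕(1−ρ)`) ON THE RECORD's OWN block fibre law.
* ★★ `shellWeightBound_crOfRecord₁₃VAt_shellSplit_of_blockFibreAC_dilation` — the same AT THE V EDITION (§0).

HONEST FRAMING.  The per-(run, K, t, cube, exterior) `SlotAntiConcentration` on the block fibre law of record is THE located estimate (NOT PRINTED ∕ NOT PROVED — the dilation road
types it on product frames `X × (κ → ℝ)`; the CHART from `(SU N)^{inputBlock a}` under product Haar with the dressed density to such a frame is NOT typed here: lens ∕ n21-w1 ∕ n21-w3 letters);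
`hsel` (live selector), (H-U), (H-ζ), `0 ≤ ζ`, widths and the polynomial letters are HYPOTHESES; `jcut` displayed; K0⁷ OPEN; nothing of Bałaban's asserted; NE7c NOT PRINTED ∕ NOT proved;
**N21 NOT discharged**; K3⁷ NOT claimed; counts UNMOVED (typed 28∕28 · discharged 5∕27); one finite four-torus programme at fixed `ε` — NOT ℝ⁴, NOT infinite volume, NOT OS, NOT a mass gap,
NOT Clay.  No decl below carries a cite tag.
-/

set_option autoImplicit false

open scoped BigOperators
open Finset MeasureTheory

namespace Summit.QuantumFields.YangMills.Theorems.N21DilationRoadAtRecord13CoPH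

open Literature.MathematicalPhysics.QuantumFieldTheory.Balaban1983to89
open Literature.MathematicalPhysics.QuantumFieldTheory.Balaban1983to89.T4Continuum
open Literature.MathematicalPhysics.QuantumFieldTheory.Balaban1983to89.Node00
open T4ShellMeasure (SlotAntiConcentration)
open T4IndicatorShell (ShellWeightBound)
open YMDAG.UVSplit (crOfRecord₁₃At crOfRecord₁₃VAt ShellSplit₁₃CoPH runA₁₃ runB₁₃ histA₁₃ histB₁₃)
open N21ShellSplitOfRecord13CoPH (WidthLetter₁₃CoPH shellSplitOfRecord₁₃At cubeStat inputBlock blockReading blockFibreLawOfDatum₉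
  shellWeightBound_crOfRecord₁₃At_shellSplit_of_blockFibreAC)

variable {F : T4Family} {N : ℕ} [NeZero N]

/-! ## §0 The shell face is volume-blind: `crOfRecord₁₃VAt ↔ crOfRecord₁₃At` -/

/-- **THE V-EDITION TRANSFER OF THE SHELL FACE** (any shell split `sh`): NE7c's `ShellWeightBound` at `crOfRecord₁₃VAt K₀ jcut sh F θ hP g₀ os` (its own canonical `Wsh`) holds iff it holds
at `crOfRecord₁₃At …` — the two readings share `l₀ ∕ T ∕ A ∕ B ∕ shA ∕ shB ∕ Wsh` literally (`Iff.rfl`); only `vol` and `δ` differ, which the shell face does not read. [bookkeeping] -/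
theorem shellWeightBound_crOfRecord₁₃VAt_iff_crOfRecord₁₃At (K₀ : ℕ) (jcut : ℕ → ℕ) (sh : ShellSplit₁₃CoPH N K₀) (θ : Stage13HParams F N) (hP : θ.Provisos₁₃CoPH F N)
    (g₀ : ℕ → ℝ) (os : List (ULoop F)) :
    (letI S := crOfRecord₁₃VAt K₀ jcut sh F θ hP g₀ os
     ShellWeightBound S.l₀ S.T S.A S.B S.shA S.shB S.Wsh) ↔
    (letI S := crOfRecord₁₃At K₀ jcut sh F θ hP g₀ os
     ShellWeightBound S.l₀ S.T S.A S.B S.shA S.shB S.Wsh) :=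
  Iff.rfl

/-! ## §1 dag-n21-d's END with the dilation constant -/

/-- ★★ **THE END OF RECORD WITH DILATION CONSTANTS.**  dag-n21-d g9's ★★★★ `shellWeightBound_crOfRecord₁₃At_shellSplit_of_blockFibreAC` with, per run, `D_K := M_K·3(d_K+1)∕(1−ρ_K)`;
its `0 ≤ D_K` ∕ `Summable (D_K ρ_K)` binders DISCHARGED by p583987 (`dilationCoeffConst_nonneg`, `summable_dilationCoeffConst_mul`); displayed instead: `0 ≤ M_K ≤ M̄(K^q+1)`,
`0 ≤ d_K ≤ d₀(K^p+1)`, `0 ≤ ρ_K ≤ ½`, `ρ_K ≤ c₁ϑ^K`, `0 ≤ ϑ < 1`, and THE ONE ESTIMATE per (run, K, |t| ≤ 1, top cube a, exterior x): `SlotAntiConcentration` of the block fibre law of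
record for the block reading of the cube statistic, below `ε_k` at relative width `ρ_K`, WITH THE DILATION CONSTANT.  HYPOTHESES only; NE7c NOT proved. [bookkeeping] -/
theorem shellWeightBound_crOfRecord₁₃At_shellSplit_of_blockFibreAC_dilation (K₀ : ℕ) (jcut : ℕ → ℕ) (ρA ρB : WidthLetter₁₃CoPH N) (θ : Stage13HParams F N)
    (hP : θ.Provisos₁₃CoPH F N) (g₀ : ℕ → ℝ) (os : List (ULoop F)) (E : B12.RunParams → ℝ)
    (hsel : θ.ppSel = ppSelLiveOfRecord F N θ.ν θ.τ9 E (wOfRecord₉ F N θ.toStage9Params))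
    (hU : LocalBgMeasurable F N θ.ν) (hζm : ZetaMeasurable F N θ.ζ) (hζ0 : ∀ p g k s Pl Ql RS U V', 0 ≤ θ.ζ p g k s Pl Ql RS U V')
    {MA dA MB dB : ℕ → ℝ} {Mbar d₀ c₁ ϑ : ℝ} {p q : ℕ} (hϑ0 : 0 ≤ ϑ) (hϑ1 : ϑ < 1)
    (hMA0 : ∀ K, 0 ≤ MA K) (hMA : ∀ K, MA K ≤ Mbar * ((K : ℝ) ^ q + 1)) (hMB0 : ∀ K, 0 ≤ MB K) (hMB : ∀ K, MB K ≤ Mbar * ((K : ℝ) ^ q + 1))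
    (hdA0 : ∀ K, 0 ≤ dA K) (hdA : ∀ K, dA K ≤ d₀ * ((K : ℝ) ^ p + 1)) (hdB0 : ∀ K, 0 ≤ dB K) (hdB : ∀ K, dB K ≤ d₀ * ((K : ℝ) ^ p + 1))
    (hρA0 : ∀ K, 0 ≤ ρA F θ hP g₀ os K) (hρAhalf : ∀ K, ρA F θ hP g₀ os K ≤ 1 / 2) (hρA : ∀ K, ρA F θ hP g₀ os K ≤ c₁ * ϑ ^ K)
    (hρB0 : ∀ K, 0 ≤ ρB F θ hP g₀ os K) (hρBhalf : ∀ K, ρB F θ hP g₀ os K ≤ 1 / 2) (hρB : ∀ K, ρB F θ hP g₀ os K ≤ c₁ * ϑ ^ K)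
    (hfibA : ∀ (K : ℕ) (t : ℝ), |t| ≤ 1 →
      ∀ (a : ↥(cubeIndices (F.P (K₀ + K)) (cubeSide (F.P (K₀ + K)).L θ.ν.M₂ (RkOfRecord (F.P (K₀ + K)).L θ.ν.r (histA₁₃ θ K₀ g₀ K (K₀ + K))) (K₀ + K))))
        (x : GaugeField (F.P (K₀ + K)) (K₀ + K) (SU N)),
        SlotAntiConcentration
          (blockFibreLawOfDatum₉ F N θ.toStage9Params (datumOfRecord₁₃CoPH F N θ hP) g₀ os (runA₁₃ F K₀ g₀ K) (histA₁₃ θ K₀ g₀ K) (K₀ + K) t a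
            (inputBlock F θ.ν (histA₁₃ θ K₀ g₀ K) a) x)
          (blockReading N (cubeStat F N θ.ν (histA₁₃ θ K₀ g₀ K) (Kc := K₀ + K) (k := K₀ + K) a) (inputBlock F θ.ν (histA₁₃ θ K₀ g₀ K) a) (fun _ => 1))
          (epsOfRecord θ.ν (histA₁₃ θ K₀ g₀ K) (K₀ + K)) (ρA F θ hP g₀ os K) (MA K * (3 * (dA K + 1) / (1 - ρA F θ hP g₀ os K))))
    (hfibB : ∀ (K : ℕ) (t : ℝ), |t| ≤ 1 →
      ∀ (a : ↥(cubeIndices (F.P (K₀ + K + 1)) (cubeSide (F.P (K₀ + K + 1)).L θ.ν.M₂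
          (RkOfRecord (F.P (K₀ + K + 1)).L θ.ν.r (histB₁₃ θ K₀ g₀ K (K₀ + K + 1))) (K₀ + K + 1))))
        (x : GaugeField (F.P (K₀ + K + 1)) (K₀ + K + 1) (SU N)),
        SlotAntiConcentration
          (blockFibreLawOfDatum₉ F N θ.toStage9Params (datumOfRecord₁₃CoPH F N θ hP) g₀ os (runB₁₃ F K₀ g₀ K) (histB₁₃ θ K₀ g₀ K) (K₀ + K + 1) t a
            (inputBlock F θ.ν (histB₁₃ θ K₀ g₀ K) a) x)
          (blockReading N (cubeStat F N θ.ν (histB₁₃ θ K₀ g₀ K) (Kc := K₀ + K + 1) (k := K₀ + K + 1) a) (inputBlock F θ.ν (histB₁₃ θ K₀ g₀ K) a) (fun _ => 1))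
          (epsOfRecord θ.ν (histB₁₃ θ K₀ g₀ K) (K₀ + K + 1)) (ρB F θ hP g₀ os K) (MB K * (3 * (dB K + 1) / (1 - ρB F θ hP g₀ os K)))) :
    letI S := crOfRecord₁₃At K₀ jcut (shellSplitOfRecord₁₃At N K₀ ρA ρB) F θ hP g₀ os
    ShellWeightBound S.l₀ S.T S.A S.B S.shA S.shB S.Wsh :=
  shellWeightBound_crOfRecord₁₃At_shellSplit_of_blockFibreAC K₀ jcut ρA ρB θ hP g₀ os E hsel hU hζm hζ0 hρA0
    (fun K => dilationCoeffConst_nonneg (hMA0 K) (hdA0 K) (by linarith [hρAhalf K])) hρB0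
    (fun K => dilationCoeffConst_nonneg (hMB0 K) (hdB0 K) (by linarith [hρBhalf K]))
    (summable_dilationCoeffConst_mul hϑ0 hϑ1 hMA0 hMA hdA0 hdA hρA0 hρAhalf hρA)
    (summable_dilationCoeffConst_mul hϑ0 hϑ1 hMB0 hMB hdB0 hdB hρB0 hρBhalf hρB) hfibA hfibB

/-- ★★ **… AT THE V EDITION** `crOfRecord₁₃VAt K₀ jcut (shellSplitOfRecord₁₃At N K₀ ρA ρB)` (`vol := F.side ^ 4`, the K3⁷ v3 pointer of record), by §0. [bookkeeping] -/
theorem shellWeightBound_crOfRecord₁₃VAt_shellSplit_of_blockFibreAC_dilation (K₀ : ℕ) (jcut : ℕ → ℕ) (ρA ρB : WidthLetter₁₃CoPH N) (θ : Stage13HParams F N)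
    (hP : θ.Provisos₁₃CoPH F N) (g₀ : ℕ → ℝ) (os : List (ULoop F)) (E : B12.RunParams → ℝ)
    (hsel : θ.ppSel = ppSelLiveOfRecord F N θ.ν θ.τ9 E (wOfRecord₉ F N θ.toStage9Params))
    (hU : LocalBgMeasurable F N θ.ν) (hζm : ZetaMeasurable F N θ.ζ) (hζ0 : ∀ p g k s Pl Ql RS U V', 0 ≤ θ.ζ p g k s Pl Ql RS U V')
    {MA dA MB dB : ℕ → ℝ} {Mbar d₀ c₁ ϑ : ℝ} {p q : ℕ} (hϑ0 : 0 ≤ ϑ) (hϑ1 : ϑ < 1)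
    (hMA0 : ∀ K, 0 ≤ MA K) (hMA : ∀ K, MA K ≤ Mbar * ((K : ℝ) ^ q + 1)) (hMB0 : ∀ K, 0 ≤ MB K) (hMB : ∀ K, MB K ≤ Mbar * ((K : ℝ) ^ q + 1))
    (hdA0 : ∀ K, 0 ≤ dA K) (hdA : ∀ K, dA K ≤ d₀ * ((K : ℝ) ^ p + 1)) (hdB0 : ∀ K, 0 ≤ dB K) (hdB : ∀ K, dB K ≤ d₀ * ((K : ℝ) ^ p + 1))
    (hρA0 : ∀ K, 0 ≤ ρA F θ hP g₀ os K) (hρAhalf : ∀ K, ρA F θ hP g₀ os K ≤ 1 / 2) (hρA : ∀ K, ρA F θ hP g₀ os K ≤ c₁ * ϑ ^ K)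
    (hρB0 : ∀ K, 0 ≤ ρB F θ hP g₀ os K) (hρBhalf : ∀ K, ρB F θ hP g₀ os K ≤ 1 / 2) (hρB : ∀ K, ρB F θ hP g₀ os K ≤ c₁ * ϑ ^ K)
    (hfibA : ∀ (K : ℕ) (t : ℝ), |t| ≤ 1 →
      ∀ (a : ↥(cubeIndices (F.P (K₀ + K)) (cubeSide (F.P (K₀ + K)).L θ.ν.M₂ (RkOfRecord (F.P (K₀ + K)).L θ.ν.r (histA₁₃ θ K₀ g₀ K (K₀ + K))) (K₀ + K))))
        (x : GaugeField (F.P (K₀ + K)) (K₀ + K) (SU N)),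
        SlotAntiConcentration
          (blockFibreLawOfDatum₉ F N θ.toStage9Params (datumOfRecord₁₃CoPH F N θ hP) g₀ os (runA₁₃ F K₀ g₀ K) (histA₁₃ θ K₀ g₀ K) (K₀ + K) t a
            (inputBlock F θ.ν (histA₁₃ θ K₀ g₀ K) a) x)
          (blockReading N (cubeStat F N θ.ν (histA₁₃ θ K₀ g₀ K) (Kc := K₀ + K) (k := K₀ + K) a) (inputBlock F θ.ν (histA₁₃ θ K₀ g₀ K) a) (fun _ => 1))
          (epsOfRecord θ.ν (histA₁₃ θ K₀ g₀ K) (K₀ + K)) (ρA F θ hP g₀ os K) (MA K * (3 * (dA K + 1) / (1 - ρA F θ hP g₀ os K))))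
    (hfibB : ∀ (K : ℕ) (t : ℝ), |t| ≤ 1 →
      ∀ (a : ↥(cubeIndices (F.P (K₀ + K + 1)) (cubeSide (F.P (K₀ + K + 1)).L θ.ν.M₂
          (RkOfRecord (F.P (K₀ + K + 1)).L θ.ν.r (histB₁₃ θ K₀ g₀ K (K₀ + K + 1))) (K₀ + K + 1))))
        (x : GaugeField (F.P (K₀ + K + 1)) (K₀ + K + 1) (SU N)),
        SlotAntiConcentration
          (blockFibreLawOfDatum₉ F N θ.toStage9Params (datumOfRecord₁₃CoPH F N θ hP) g₀ os (runB₁₃ F K₀ g₀ K) (histB₁₃ θ K₀ g₀ K) (K₀ + K + 1) t a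
            (inputBlock F θ.ν (histB₁₃ θ K₀ g₀ K) a) x)
          (blockReading N (cubeStat F N θ.ν (histB₁₃ θ K₀ g₀ K) (Kc := K₀ + K + 1) (k := K₀ + K + 1) a) (inputBlock F θ.ν (histB₁₃ θ K₀ g₀ K) a) (fun _ => 1))
          (epsOfRecord θ.ν (histB₁₃ θ K₀ g₀ K) (K₀ + K + 1)) (ρB F θ hP g₀ os K) (MB K * (3 * (dB K + 1) / (1 - ρB F θ hP g₀ os K)))) :
    letI S := crOfRecord₁₃VAt K₀ jcut (shellSplitOfRecord₁₃At N K₀ ρA ρB) F θ hP g₀ os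
    ShellWeightBound S.l₀ S.T S.A S.B S.shA S.shB S.Wsh :=
  (shellWeightBound_crOfRecord₁₃VAt_iff_crOfRecord₁₃At K₀ jcut (shellSplitOfRecord₁₃At N K₀ ρA ρB) θ hP g₀ os).2
    (shellWeightBound_crOfRecord₁₃At_shellSplit_of_blockFibreAC_dilation K₀ jcut ρA ρB θ hP g₀ os E hsel hU hζm hζ0 hϑ0 hϑ1 hMA0 hMA hMB0 hMB hdA0 hdA
      hdB0 hdB hρA0 hρAhalf hρA hρB0 hρBhalf hρB hfibA hfibB)

end Summit.QuantumFields.YangMills.Theorems.N21DilationRoadAtRecord13CoPH
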